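import Summits.QuantumFields.YangMills.Theorems.BalabanUVNodesN12GaugeLetterLocAtRecordLam
import Summits.QuantumFields.YangMills.Theorems.BalabanUVNodesN12GaugeLetterLocOfClass
import HarnessLib

/-!
# BalabanUVNodes ∕ N12 — THE PLAQUETTE LETTER OF THE (σ)_N CAPSTONE IS THE MINIMISER's CLASS, AT PRINT's DATUM `Λ(Z) = lamBondsSeq (maxDomT ν.M₁ Z) k` ([Balaban1984PropagatorsII] (2.3)):
# this lane's `…N12GaugeLetterLocOfClass.exists_gaugeLetterLoc_atRecord_of_class` RE-KEYED — the level-form boxes around the sources of the bonds of the ONE-LAYER EXTENSION `Ωx(Z)` of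
# `Ω₁(Z)` (the crossing bonds and their outside ends: LOCATED-2) still lie in the support `Ω₀ = hullD M₁ 1 Ω₁` of [III] (2.13), where [15] (2) at scale `0` makes every plaquette of `U₀`
# `εreg`-small — O1 module (5) of the gauge-letter chain (dag-n12-d CEDE ∕ dag-lead WORDS 426∕427∕430, pub-ymgap INBOX 2026-08-30); over O1 (4) `…N12GaugeLetterLocAtRecordLam`

[Balaban1984PropagatorsII] = «[II]», (2.3) p. 224; [Balaban1985Variational] = «[15]», (2)–(4) p. 278, Thm 1 (8) p. 279, (16)–(18) p. 280; [Balaban1985RegularSpaces] = «[6]», (1.7) p. 77, (1.19) p. 79;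
[Balaban1988Convergent] = «[III]», p. 255 («support»), (2.12)–(2.13) pp. 256–257; [Balaban1987RG1] = «[RG1]», (0.1) p. 251, (0.4) p. 253.

Cell `pub-ymgap` (HUMAN RULINGS D-0062 ∕ D-0149), lane `pub-ymgap-dag-n12-c` g37 (R134 seat (a), N12 = [B15], s1, lane owner); `--kind proof --supports` K1⁹ `stmt-QuantumFields-27364` `--as helper`;
count-neutral.  THEOREMS ONLY (0 `def`, 0 `instance`, 0 `sorry`); by name over O1 (4) `…N12GaugeLetterLocAtRecordLam.exists_gaugeLetterLoc_atRecord_lamBondsSeq` (the capstone at print's datum), the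
parent's §1 geometry `…N12GaugeLetterLocOfClass.exists_cover_of_mem_boxPlaqs` ∕ `boxPlaqs_src_mem_hullD` (datum-free, REUSED), `…N12BjRootChainsLam.exists_rootChain_lamBondsSeq_graded_touching`
(`|J − J′| ≤ 1` for a bond touching `Ω₁(Z)`), `…N12BjCollarRoots`, r15's `B15Claim189CubePin.cover_add_single`, NODE 00's `Node00.cover_mem_hullD_one_of_within`, the class of record
`Node00.regMSCoPOfRecord` = [15] (2) on the support `Node00.suppDomOfRecord = hullD M₁ 1 Ω₁`.  The STATEMENT is the parent's text (tree bytes, `work/gen_glofclass_lam.py`) with `hmin ↦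
IsMinimizerB … (lamBondsSeq (maxDomT ν.M₁ Z) k) …`, `ha`∕`hWj`∕`hu` on print members, Cin on ALL of `N`; the numeric hypothesis `hRad` is UNCHANGED (its `J = 1` row already places the boxes of
the collar bonds, radius `R(0, ≤1) ≤ R(1) − 1`, in the support layer).  DECL MAP (old → new): `N12GaugeLetterLocOfClass.exists_gaugeLetterLoc_atRecord_of_class ↦
N12GaugeLetterLocOfClassLam.exists_gaugeLetterLoc_atRecord_lamBondsSeq_of_class`; `exists_cover_of_mem_boxPlaqs`, `boxPlaqs_src_mem_hullD` unchanged (parent).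

WHY.  O1 (4) displays the graded plaquette letter on the bonds inside `Ωx(Z) = {end-points of bonds touching Ω₁(Z)}`; for a bond whose source lies in `Ω₁(Z)` the parent's §1 applies
verbatim (source in `Ω_J`, `J ≥ 1`); for a bond whose source lies OFF `Ω₁(Z)` (then it is ADJACENT to `Ω₁(Z)`, its `Γ`-level is `0` and its target's level is `≤ 1` by the collar) the box of
radius `R(0, J′) ≤ 2ℓ₁ + 1 + m·L + ℓ₀` around the source sits within `R + 3 ≤ M₁` of an integer point covering a site of `Ω₁(Z)`, hence in the support's one layer of `M₁`-cubes
(`Node00.cover_mem_hullD_one_of_within`) — §1 below; the needed `R(0, J′) + 4 ≤ M₁` follows from the parent's `hRad` at `J = 1` since `ℓ₂ ≥ ℓ₁ + 1`, `ℓ₁ ≥ ℓ₀ + 1`.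

HONEST FRAMING.  Composition by name + lattice bookkeeping; the minimiser ([15] Thm 1 ∕ (E)), the region datum, the `N`-geometry, the plaquette letter on the iterated averages ([Balaban1985Averaging]
Prop. 1–2, local), the datum letter and the numerics stay HYPOTHESES; nothing of Bałaban's asserted or refuted; count-neutral helper (`--supports 27364`); N12 NOT discharged; K0⁷∕K1⁹ NOT closed;
counts of record unmoved (typed 28∕28 · discharged 8∕27); one finite 𝕋⁴ programme at fixed ε — R4 closes the conditional rung `BalabanLadder.UV` only; the Yang–Mills mass gap (Clay) is NOT proved
by any of this; nothing continuum ∕ ℝ⁴ ∕ OS.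
-/

noncomputable section

open scoped Matrix.Norms.L2Operator BigOperators

namespace Summit.QuantumFields.YangMills.BalabanUVNodes.N12GaugeLetterLocOfClassLam

open Literature.MathematicalPhysics.QuantumFieldTheory.Balaban1983to89
open T4Continuum GaugeField B15DeterminingSets B15DeterminingSetsB BlockAveraging
open T4CubeChartGnomonic (SU2)
open B16Sect1Backgrounds (toMS)
open T4AxialGaugeSmallField (boxPlaqs castSite)
open B14.Eq213MaximalDomains (side)
open B14.Eq213DetSet (Bj Bj_zero maxDomT maxDomT_antitone dist_maxDomT)
open B14.Eq22Determines (blockIter)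
open B14DomainGeom (Within)
open B15Eq112TorusCover (cover lift cover_lift cover_apply)
open B5Eq118OneStroke (iterBlockOf)
open B7Prop1Explicit (e e_apply)
open B8Eq17ClassAkV1 (plaqsOf)
open ExpMeanLog (deltaSU)
open Literature.MathematicalPhysics.QuantumFieldTheory.BalabanImbrieJaffe1984to88.BIJ85Eq453GaugeField (qsstarGIter0)
open Summit.QuantumFields.YangMills.BalabanUVNodes.N12BjCollarRoots (le_of_iterBlockOf_mem_Bj mem_maxDomT_of_iterBlockOf_mem_Bj eq_of_iterBlockOf_mem_Bj)
open Summit.QuantumFields.YangMills.BalabanUVNodes.N12BjRootChainsLam (exists_rootChain_lamBondsSeq_graded_touching)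
open Summit.QuantumFields.YangMills.BalabanUVNodes.N12GaugeLetterLocOfClass (exists_cover_of_mem_boxPlaqs boxPlaqs_src_mem_hullD)
open Summit.QuantumFields.YangMills.BalabanUVNodes.N12GaugeLetterLocAtRecordLam (exists_gaugeLetterLoc_atRecord_lamBondsSeq)

variable {P : Params}

/-! ## §1 The boxes around the collar bonds lie in the support layer -/

section Geometry

/-- **A SITE OF THE ONE-LAYER EXTENSION `Ωx(Z)` IS IN `Ω₁(Z)` OR NEXT TO AN INTEGER POINT COVERING A SITE OF `Ω₁(Z)`** (the neighbour along the witnessing bond, lifted next to `lift x` —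
no wrap: `π(lift x ± e_μ) = x ± e_μ`, r15's `cover_add_single`). [cite: Balaban1987RG1, (0.1) p.251 (the torus; bookkeeping); Balaban1988Convergent, (2.13) pp.256–257] -/
theorem mem_or_exists_near_of_mem_extension {M₁ : ℕ} {Z : Set (Site P 0)} {x : Site P 0}
    (hx : x ∈ {z : Site P 0 | ∃ b' : PBond P 0, (b'.src ∈ maxDomT M₁ Z 1 ∨ b'.tgt ∈ maxDomT M₁ Z 1) ∧ (z = b'.src ∨ z = b'.tgt)}) :
    x ∈ maxDomT M₁ Z 1 ∨ ∃ y : Fin P.d → ℤ, cover P y ∈ maxDomT M₁ Z 1 ∧ Within 1 (lift P x) y := by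
  classical
  by_cases hxΩ : x ∈ maxDomT M₁ Z 1
  · exact Or.inl hxΩ
  right
  obtain ⟨b', hb', hxb⟩ := hx
  have hsingle : ∀ (μ i : Fin P.d), |(Pi.single μ (1 : ℤ) : Fin P.d → ℤ) i| ≤ 1 := fun μ i => by
    by_cases h : i = μ
    · subst h; simp
    · simp [h]
  rcases hxb with rfl | rfl
  · -- `x = b'₋ ∉ Ω₁`, so `b'₊ ∈ Ω₁`: the point `lift x + e_μ`
    have ht : b'.tgt ∈ maxDomT M₁ Z 1 := hb'.resolve_left hxΩ
    refine ⟨lift P b'.src + Pi.single b'.dir 1, ?_, fun i => ?_⟩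
    · rw [B15Claim189CubePin.cover_add_single, cover_lift]; exact ht
    · simp only [Pi.add_apply, sub_add_cancel_left, abs_neg]; exact hsingle _ _
  · -- `x = b'₊ ∉ Ω₁`, so `b'₋ ∈ Ω₁`: the point `lift x − e_μ`
    have hs : b'.src ∈ maxDomT M₁ Z 1 := hb'.resolve_right hxΩ
    refine ⟨lift P b'.tgt - Pi.single b'.dir 1, ?_, fun i => ?_⟩
    · have e1 : cover P (lift P b'.tgt - Pi.single b'.dir 1 + Pi.single b'.dir 1) = (cover P (lift P b'.tgt - Pi.single b'.dir 1)).shift b'.dir :=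
        B15Claim189CubePin.cover_add_single _ b'.dir
      rw [sub_add_cancel, cover_lift] at e1
      have e2 : ((cover P (lift P b'.tgt - Pi.single b'.dir 1)).shift b'.dir).unshift b'.dir = (b'.tgt : Site P 0).unshift b'.dir :=
        congrArg (fun y : Site P 0 => y.unshift b'.dir) e1.symm
      rw [Site.unshift_shift] at e2
      -- `b'₊ − e_μ = b'₋`
      have e3 : (b'.tgt : Site P 0).unshift b'.dir = b'.src := Site.unshift_shift b'.src b'.dir
      rw [e2, e3]; exact hs
    · simp only [Pi.sub_apply, sub_sub_cancel]; exact hsingle _ _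

/-- ★★ **THE BOXES AROUND A SITE NEXT TO `Ω₁(Z)` LIE IN THE SUPPORT LAYER**: if `lift x` is within `1` of an integer point covering a site of `Ω₁(Z)` and `R + 4 ≤ M₁`, every plaquette of the
coordinate box of radius `R` (+2) around `x` has its source in `hullD M₁ 1 Ω₁` (the one layer of `M₁`-cubes of the support, `Node00.cover_mem_hullD_one_of_within`).
[cite: Balaban1988Convergent, p.255 («support»), (2.13) pp.256–257; Balaban1985Variational, (2) p.278] -/
theorem boxPlaqs_src_mem_hullD_of_near {M₁ : ℕ} {Z : Set (Site P 0)} (hM : 1 ≤ M₁) {x : Site P 0} {y : Fin P.d → ℤ}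
    (hy : cover P y ∈ maxDomT M₁ Z 1) (hxy : Within 1 (lift P x) y) {R : ℕ} (hR : R + 4 ≤ M₁)
    {p : Plaq P 0} (hp : p ∈ (boxPlaqs (fun κ => ((x κ).val : ℤ) - (R : ℤ)) (fun κ => ((x κ).val : ℤ) + (R : ℤ) + 2) : Set (Plaq P 0))) :
    p.src ∈ Node00.hullD P M₁ 1 (maxDomT M₁ Z 1) := by
  obtain ⟨z, hsrc, hw⟩ := exists_cover_of_mem_boxPlaqs x R hp
  rw [hsrc]
  refine Node00.cover_mem_hullD_one_of_within (by omega) hy fun i => ?_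
  have h1 := hw i
  have h2 := hxy i
  rw [abs_le] at h1 h2 ⊢
  constructor <;> omega

end Geometry

/-! ## §2 (σ)_N at print's datum with the plaquette letter of `U₀` read off the class -/

section Record

/-- ★★★ **(σ)_N AT THE RECORD FOR PRINT's DATUM, THE PLAQUETTE LETTER OF `U₀` BEING THE CLASS.**  As `…N12GaugeLetterLocAtRecordLam.exists_gaugeLetterLoc_atRecord_lamBondsSeq`, but the graded
root-free plaquette letter on the bonds of `Ωx(Z)` is DISCHARGED: `S := plaqsOf Ω₀` (`Ω₀ = suppDomOfRecord = hullD M₁ 1 Ω₁`), `εP := εreg·η₀²`, `PlaqSmallOn S εP U₀` from the minimiser's class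
([15] (2) at scale `0`, `hmin.1`), the boxes inside `Ω₀` by the parent's §1 (source in `Ω₁(Z)`) and this file's §1 (source in the collar) under the parent's ONE numeric hypothesis `R(J) + 3 ≤
L^{J−1}·M₁` for `1 ≤ J ≤ k` (`0 ≤ εreg`).  DISPLAYED: the minimiser ON `Λ(Z)` in NODE 00's class, the region datum `W 𝒞 ρn`, the `N`-geometry, the plaquette letter `a_j`∕`θ` on the iterated
averages near PRINT-member segments, the datum letter `hWj` on print members, no wrapping, the radius numerics.  Conclusion: (σ)_N with tolerance `max ρn (((2ℓ_k+1+m·L^k)²∕4)·(εreg·η₀²) + m·θ_k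
+ m·δ₁)`, `hu` on `Λ(Z)`, Cin on all of `N`. [cite: Balaban1984PropagatorsII, (2.3) p.224; Balaban1985Variational, (2)–(4) p.278, Thm 1 (8) p.279, (16)–(18) p.280; Balaban1985RegularSpaces, (1.7) p.77, (1.19) p.79; Balaban1988Convergent, p.255, (2.12)–(2.13) pp.256–257; Balaban1987RG1, (0.4) p.253] -/
theorem exists_gaugeLetterLoc_atRecord_lamBondsSeq_of_class {F : T4Family} (ν : Node00.Stage7Numerics) (Kt : ℕ) {k : ℕ} (hk0 : 0 < k) (hk : k ≤ (F.P Kt).m + (F.P Kt).K)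
    (hM2 : 2 ≤ ν.M₁) (hdiv : side (F.P Kt).L ν.M₁ k ∣ (F.P Kt).sitesPerDir 0) (Z : Set (Site (F.P Kt) 0)) (hεreg : 0 ≤ ν.εreg)
    -- no wrapping, at the caps `ℓ_k`, `m·L^k`
    (hN : 2 * (∑ i ∈ Finset.range (k + 1), ((F.P Kt).d * (((F.P Kt).L ^ i - 1) / 2) + 1)) + 1 +
      (3 * ((F.P Kt).d * (((F.P Kt).L - 1) / 2)) + 5) * (F.P Kt).L ^ k < (F.P Kt).sitesPerDir 0)
    -- radius numerics: the level-`J` box fits the collar `L^{J−1}·M₁`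
    (hRad : ∀ J, 1 ≤ J → J ≤ k →
      (2 * ∑ i ∈ Finset.range (J + 1 + 1), ((F.P Kt).d * (((F.P Kt).L ^ i - 1) / 2) + 1)) + 1 +
          (3 * ((F.P Kt).d * (((F.P Kt).L - 1) / 2)) + 5) * (F.P Kt).L ^ min (J + 1) k +
        (∑ i ∈ Finset.range (J + 1), ((F.P Kt).d * (((F.P Kt).L ^ i - 1) / 2) + 1)) + 3 ≤ (F.P Kt).L ^ (J - 1) * ν.M₁)
    -- the region-normalised datum and the minimiser
    {ρn : ℝ} (hρn : 0 ≤ ρn)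
    (W : GaugeField (F.P Kt) k SU2) (𝒞 : Set (PBond (F.P Kt) k)) (hD : ∀ c ∈ 𝒞, dist1 (W c) ≤ ρn)
    {U₀ : GaugeField (F.P Kt) 0 SU2}
    (hmin : IsMinimizerB (Node00.avOfRecord F 2 Kt) (Node00.regMSCoPOfRecord F 2 ν Kt k (maxDomT ν.M₁ Z)) (lamBondsSeq (maxDomT ν.M₁ Z) k)
      (avgFamily (Node00.avOfRecord F 2 Kt) (qsstarGIter0 k W)) U₀)
    -- geometry of the neighbourhood (dag-n12-w6's letters, verbatim)
    (N : Set (PBond (F.P Kt) 0))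
    (hGN : ∀ b ∈ N, (b.src ∉ maxDomT ν.M₁ Z 1 ∨ b.tgt ∉ maxDomT ν.M₁ Z 1) → blockIter k b.tgt ≠ blockIter k b.src →
      (⟨blockIter k b.src, b.dir⟩ : PBond (F.P Kt) k) ∈ 𝒞)
    (hN1 : ∀ p : Plaq (F.P Kt) 0, ((⟨p.src, p.μ⟩ : PBond (F.P Kt) 0) ∈ {b : PBond (F.P Kt) 0 | b.src ∈ maxDomT ν.M₁ Z 1} ∨
        (⟨p.src.shift p.μ, p.ν⟩ : PBond (F.P Kt) 0) ∈ {b : PBond (F.P Kt) 0 | b.src ∈ maxDomT ν.M₁ Z 1} ∨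
        (⟨p.src.shift p.ν, p.μ⟩ : PBond (F.P Kt) 0) ∈ {b : PBond (F.P Kt) 0 | b.src ∈ maxDomT ν.M₁ Z 1} ∨
        (⟨p.src, p.ν⟩ : PBond (F.P Kt) 0) ∈ {b : PBond (F.P Kt) 0 | b.src ∈ maxDomT ν.M₁ Z 1}) →
      (⟨p.src, p.μ⟩ : PBond (F.P Kt) 0) ∈ N ∧ (⟨p.src.shift p.μ, p.ν⟩ : PBond (F.P Kt) 0) ∈ N ∧
        (⟨p.src.shift p.ν, p.μ⟩ : PBond (F.P Kt) 0) ∈ N ∧ (⟨p.src, p.ν⟩ : PBond (F.P Kt) 0) ∈ N)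
    -- DISPLAYED: the plaquette letter on the iterated averages near the member segments, with its budgets
    (a θ : ℕ → ℝ) (hθ0 : 0 ≤ θ 0) (ha0 : ∀ j, 0 ≤ a j)
    (haN : ∀ j < k, (((((F.P Kt).d + 2) * (F.P Kt).L : ℕ) : ℝ) ^ 2 / 4) * a j < deltaSU (Fin 2))
    (hθ : ∀ j, 6 * ((((((F.P Kt).d + 2) * (F.P Kt).L : ℕ) : ℝ) ^ 2 / 4) * a j) + (F.P Kt).L * θ j ≤ θ (j + 1))
    (ha : ∀ i ≤ k, ∀ c ∈ lamBondsSeq (maxDomT ν.M₁ Z) k i, ∀ j < i, ∀ c' : PBond (F.P Kt) (j + 1), c'.dir = c.dir →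
      (∃ s < (F.P Kt).L ^ i, embIter (j + 1) c'.src = (fun z : Site (F.P Kt) 0 => z.shift c.dir)^[s] (embIter i c.src)) →
      ∀ q : Plaq (F.P Kt) j, (blockOf q.src = c'.src.unshift c'.dir ∨ blockOf q.src = c'.src ∨ blockOf q.src = c'.tgt) →
        dist1 (GaugeField.plaqHol (avgFamily (Node00.avOfRecord F 2 Kt) U₀ j) q) < a j)
    -- DISPLAYED: the datum letter at the members (levels `≤ k`)
    {δ₁ : ℝ} (hδ0 : 0 ≤ δ₁) (hWj : ∀ i ≤ k, ∀ c ∈ lamBondsSeq (maxDomT ν.M₁ Z) k i, dist1 (avgFamily (Node00.avOfRecord F 2 Kt) (qsstarGIter0 k W) i c) ≤ δ₁) :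
    ∃ σ : GaugeTransf (F.P Kt) 0 SU2,
      (∀ j, j ≤ k → ∀ b ∈ lamBondsSeq (maxDomT ν.M₁ Z) k j, toMS σ j b.src = 1 ∧ toMS σ j b.tgt = 1) ∧
        (∀ p : Plaq (F.P Kt) 0, ((⟨p.src, p.μ⟩ : PBond (F.P Kt) 0) ∈ {b : PBond (F.P Kt) 0 | b.src ∈ maxDomT ν.M₁ Z 1} ∨
            (⟨p.src.shift p.μ, p.ν⟩ : PBond (F.P Kt) 0) ∈ {b : PBond (F.P Kt) 0 | b.src ∈ maxDomT ν.M₁ Z 1} ∨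
            (⟨p.src.shift p.ν, p.μ⟩ : PBond (F.P Kt) 0) ∈ {b : PBond (F.P Kt) 0 | b.src ∈ maxDomT ν.M₁ Z 1} ∨
            (⟨p.src, p.ν⟩ : PBond (F.P Kt) 0) ∈ {b : PBond (F.P Kt) 0 | b.src ∈ maxDomT ν.M₁ Z 1}) →
          ‖((gaugeAct σ U₀ ⟨p.src, p.μ⟩ : SU2) : Matrix (Fin 2) (Fin 2) ℂ) - 1‖ ≤
              max ρn ((((2 * (∑ i ∈ Finset.range (k + 1), ((F.P Kt).d * (((F.P Kt).L ^ i - 1) / 2) + 1)) + 1 +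
                  (3 * ((F.P Kt).d * (((F.P Kt).L - 1) / 2)) + 5) * (F.P Kt).L ^ k : ℕ) : ℝ)) ^ 2 / 4 * (ν.εreg * (F.P Kt).eta 0 ^ 2) +
                ((3 * ((F.P Kt).d * (((F.P Kt).L - 1) / 2)) + 5 : ℕ) : ℝ) * θ k + ((3 * ((F.P Kt).d * (((F.P Kt).L - 1) / 2)) + 5 : ℕ) : ℝ) * δ₁) ∧
            ‖((gaugeAct σ U₀ ⟨p.src.shift p.μ, p.ν⟩ : SU2) : Matrix (Fin 2) (Fin 2) ℂ) - 1‖ ≤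
              max ρn ((((2 * (∑ i ∈ Finset.range (k + 1), ((F.P Kt).d * (((F.P Kt).L ^ i - 1) / 2) + 1)) + 1 +
                  (3 * ((F.P Kt).d * (((F.P Kt).L - 1) / 2)) + 5) * (F.P Kt).L ^ k : ℕ) : ℝ)) ^ 2 / 4 * (ν.εreg * (F.P Kt).eta 0 ^ 2) +
                ((3 * ((F.P Kt).d * (((F.P Kt).L - 1) / 2)) + 5 : ℕ) : ℝ) * θ k + ((3 * ((F.P Kt).d * (((F.P Kt).L - 1) / 2)) + 5 : ℕ) : ℝ) * δ₁) ∧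
            ‖((gaugeAct σ U₀ ⟨p.src.shift p.ν, p.μ⟩ : SU2) : Matrix (Fin 2) (Fin 2) ℂ) - 1‖ ≤
              max ρn ((((2 * (∑ i ∈ Finset.range (k + 1), ((F.P Kt).d * (((F.P Kt).L ^ i - 1) / 2) + 1)) + 1 +
                  (3 * ((F.P Kt).d * (((F.P Kt).L - 1) / 2)) + 5) * (F.P Kt).L ^ k : ℕ) : ℝ)) ^ 2 / 4 * (ν.εreg * (F.P Kt).eta 0 ^ 2) +
                ((3 * ((F.P Kt).d * (((F.P Kt).L - 1) / 2)) + 5 : ℕ) : ℝ) * θ k + ((3 * ((F.P Kt).d * (((F.P Kt).L - 1) / 2)) + 5 : ℕ) : ℝ) * δ₁) ∧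
            ‖((gaugeAct σ U₀ ⟨p.src, p.ν⟩ : SU2) : Matrix (Fin 2) (Fin 2) ℂ) - 1‖ ≤
              max ρn ((((2 * (∑ i ∈ Finset.range (k + 1), ((F.P Kt).d * (((F.P Kt).L ^ i - 1) / 2) + 1)) + 1 +
                  (3 * ((F.P Kt).d * (((F.P Kt).L - 1) / 2)) + 5) * (F.P Kt).L ^ k : ℕ) : ℝ)) ^ 2 / 4 * (ν.εreg * (F.P Kt).eta 0 ^ 2) +
                ((3 * ((F.P Kt).d * (((F.P Kt).L - 1) / 2)) + 5 : ℕ) : ℝ) * θ k + ((3 * ((F.P Kt).d * (((F.P Kt).L - 1) / 2)) + 5 : ℕ) : ℝ) * δ₁)) ∧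
        (∀ b ∈ N,
          ‖((gaugeAct σ U₀ b : SU2) : Matrix (Fin 2) (Fin 2) ℂ) - 1‖ ≤
              max ρn ((((2 * (∑ i ∈ Finset.range (k + 1), ((F.P Kt).d * (((F.P Kt).L ^ i - 1) / 2) + 1)) + 1 +
                  (3 * ((F.P Kt).d * (((F.P Kt).L - 1) / 2)) + 5) * (F.P Kt).L ^ k : ℕ) : ℝ)) ^ 2 / 4 * (ν.εreg * (F.P Kt).eta 0 ^ 2) +
                ((3 * ((F.P Kt).d * (((F.P Kt).L - 1) / 2)) + 5 : ℕ) : ℝ) * θ k + ((3 * ((F.P Kt).d * (((F.P Kt).L - 1) / 2)) + 5 : ℕ) : ℝ) * δ₁)) := by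
  have hM : 1 ≤ ν.M₁ := by omega
  have hk1 : 1 ≤ k := hk0
  -- the class at scale `0`: every plaquette of the support is `εreg·η₀²`-small
  have hclass := (Node00.mem_regMSCoPOfRecordAt_iff F 2 ν Kt k (Node00.suppDomOfRecord F ν Kt (maxDomT ν.M₁ Z)) (maxDomT ν.M₁ Z) U₀).1 hmin.1
  have hP : PlaqSmallOn (plaqsOf (Node00.suppDomOfRecord F ν Kt (maxDomT ν.M₁ Z))) (ν.εreg * (F.P Kt).eta 0 ^ 2) U₀ := by
    have h := hclass.1 0 (Nat.zero_le k)
    rwa [Node00.topSeq_zero] at h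
  have hεP : 0 ≤ ν.εreg * (F.P Kt).eta 0 ^ 2 := mul_nonneg hεreg (pow_nonneg (by unfold Params.eta; positivity) 2)
  -- the sums `ℓ_J` grow with `J`, by at least one per level
  have hℓmono : ∀ {a b : ℕ}, a ≤ b → ∑ i ∈ Finset.range (a + 1), ((F.P Kt).d * (((F.P Kt).L ^ i - 1) / 2) + 1) ≤
      ∑ i ∈ Finset.range (b + 1), ((F.P Kt).d * (((F.P Kt).L ^ i - 1) / 2) + 1) := fun {a b} hab => by
    apply Finset.sum_le_sum_of_subset
    intro i hi
    simp only [Finset.mem_range] at hi ⊢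
    omega
  have hℓsucc : ∀ a : ℕ, ∑ i ∈ Finset.range (a + 1), ((F.P Kt).d * (((F.P Kt).L ^ i - 1) / 2) + 1) + 1 ≤
      ∑ i ∈ Finset.range (a + 1 + 1), ((F.P Kt).d * (((F.P Kt).L ^ i - 1) / 2) + 1) := fun a => by
    rw [Finset.sum_range_succ _ (a + 1)]
    omega
  have hLmono : (F.P Kt).L ^ min (0 + 1) k ≤ (F.P Kt).L ^ min (1 + 1) k :=
    Nat.pow_le_pow_right (F.P Kt).L_pos (min_le_min_right k (by omega))
  -- the graded boxes around the bonds of `Ωx(Z)` lie in the support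
  have hSΩ : ∀ b : PBond (F.P Kt) 0,
      b.src ∈ {z : Site (F.P Kt) 0 | ∃ b' : PBond (F.P Kt) 0, (b'.src ∈ maxDomT ν.M₁ Z 1 ∨ b'.tgt ∈ maxDomT ν.M₁ Z 1) ∧ (z = b'.src ∨ z = b'.tgt)} →
      b.tgt ∈ {z : Site (F.P Kt) 0 | ∃ b' : PBond (F.P Kt) 0, (b'.src ∈ maxDomT ν.M₁ Z 1 ∨ b'.tgt ∈ maxDomT ν.M₁ Z 1) ∧ (z = b'.src ∨ z = b'.tgt)} →
      ∀ J J' : ℕ, iterBlockOf J b.src ∈ (Bj ν.M₁ Z k : DetSet (F.P Kt)) J → iterBlockOf J' b.tgt ∈ (Bj ν.M₁ Z k : DetSet (F.P Kt)) J' →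
      (boxPlaqs
          (fun κ => ((b.src κ).val : ℤ) -
            (((2 * max (∑ i ∈ Finset.range (J + 1), ((F.P Kt).d * (((F.P Kt).L ^ i - 1) / 2) + 1))
                  (∑ i ∈ Finset.range (J' + 1), ((F.P Kt).d * (((F.P Kt).L ^ i - 1) / 2) + 1)) + 1 +
                (3 * ((F.P Kt).d * (((F.P Kt).L - 1) / 2)) + 5) * (F.P Kt).L ^ min (J + 1) k) +
              ∑ i ∈ Finset.range (J + 1), ((F.P Kt).d * (((F.P Kt).L ^ i - 1) / 2) + 1) : ℕ) : ℤ))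
          (fun κ => ((b.src κ).val : ℤ) +
            (((2 * max (∑ i ∈ Finset.range (J + 1), ((F.P Kt).d * (((F.P Kt).L ^ i - 1) / 2) + 1))
                  (∑ i ∈ Finset.range (J' + 1), ((F.P Kt).d * (((F.P Kt).L ^ i - 1) / 2) + 1)) + 1 +
                (3 * ((F.P Kt).d * (((F.P Kt).L - 1) / 2)) + 5) * (F.P Kt).L ^ min (J + 1) k) +
              ∑ i ∈ Finset.range (J + 1), ((F.P Kt).d * (((F.P Kt).L ^ i - 1) / 2) + 1) : ℕ) : ℤ) + 2) : Set (Plaq (F.P Kt) 0)) ⊆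
        plaqsOf (Node00.suppDomOfRecord F ν Kt (maxDomT ν.M₁ Z)) := by
    intro b hbs hbt J J' hJ hJ' p hp
    have hJk : J ≤ k := le_of_iterBlockOf_mem_Bj hJ
    by_cases hb1 : b.src ∈ maxDomT ν.M₁ Z 1
    · -- source in `Ω₁(Z)`: the parent's geometry verbatim
      have hJ1 : 1 ≤ J := by
        by_contra h
        have hJ0 : J = 0 := by omega
        subst hJ0
        rw [Bj_zero (by omega)] at hJ
        exact hJ hb1
      obtain ⟨⟨-, hJ'le⟩, -⟩ := exists_rootChain_lamBondsSeq_graded_touching hk hk1 hM2 hdiv b (Or.inl hb1) hJ hJ'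
      have hxΩ : b.src ∈ maxDomT ν.M₁ Z J := mem_maxDomT_of_iterBlockOf_mem_Bj hM hdiv hk hJ1 hJ
      set R : ℕ := (2 * max (∑ i ∈ Finset.range (J + 1), ((F.P Kt).d * (((F.P Kt).L ^ i - 1) / 2) + 1))
            (∑ i ∈ Finset.range (J' + 1), ((F.P Kt).d * (((F.P Kt).L ^ i - 1) / 2) + 1)) + 1 +
          (3 * ((F.P Kt).d * (((F.P Kt).L - 1) / 2)) + 5) * (F.P Kt).L ^ min (J + 1) k) +
        ∑ i ∈ Finset.range (J + 1), ((F.P Kt).d * (((F.P Kt).L ^ i - 1) / 2) + 1) with hRdef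
      have hmax : max (∑ i ∈ Finset.range (J + 1), ((F.P Kt).d * (((F.P Kt).L ^ i - 1) / 2) + 1))
          (∑ i ∈ Finset.range (J' + 1), ((F.P Kt).d * (((F.P Kt).L ^ i - 1) / 2) + 1)) ≤
          ∑ i ∈ Finset.range (J + 1 + 1), ((F.P Kt).d * (((F.P Kt).L ^ i - 1) / 2) + 1) :=
        max_le (hℓmono (Nat.le_succ J)) (hℓmono hJ'le)
      have hR : R + 3 ≤ (F.P Kt).L ^ (J - 1) * ν.M₁ := by
        have h := hRad J hJ1 hJk
        omega
      exact Or.inl (boxPlaqs_src_mem_hullD hM hdiv hJ1 hJk hxΩ hR hp)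
    · -- source in the collar: `Γ`-level `0`, target level `≤ 1`, box in the support layer (§1)
      have hJ0' : iterBlockOf 0 b.src ∈ (Bj ν.M₁ Z k : DetSet (F.P Kt)) 0 := by rw [Bj_zero (by omega)]; exact hb1
      have hJ0 : J = 0 := eq_of_iterBlockOf_mem_Bj hM hdiv hk hJ hJ0'
      subst hJ0
      have hJ'le : J' ≤ 1 := by
        by_cases hb2 : b.tgt ∈ maxDomT ν.M₁ Z 1
        · obtain ⟨⟨-, h⟩, -⟩ := exists_rootChain_lamBondsSeq_graded_touching hk hk1 hM2 hdiv b (Or.inr hb2) hJ hJ'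
          omega
        · have h0 : iterBlockOf 0 b.tgt ∈ (Bj ν.M₁ Z k : DetSet (F.P Kt)) 0 := by rw [Bj_zero (by omega)]; exact hb2
          have := eq_of_iterBlockOf_mem_Bj hM hdiv hk hJ' h0
          omega
      obtain ⟨y, hy, hxy⟩ := (mem_or_exists_near_of_mem_extension hbs).resolve_left hb1
      set R : ℕ := (2 * max (∑ i ∈ Finset.range (0 + 1), ((F.P Kt).d * (((F.P Kt).L ^ i - 1) / 2) + 1))
            (∑ i ∈ Finset.range (J' + 1), ((F.P Kt).d * (((F.P Kt).L ^ i - 1) / 2) + 1)) + 1 +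
          (3 * ((F.P Kt).d * (((F.P Kt).L - 1) / 2)) + 5) * (F.P Kt).L ^ min (0 + 1) k) +
        ∑ i ∈ Finset.range (0 + 1), ((F.P Kt).d * (((F.P Kt).L ^ i - 1) / 2) + 1) with hRdef
      -- `R + 4 ≤ M₁` from the parent's numerics at `J = 1`
      have hmax : max (∑ i ∈ Finset.range (0 + 1), ((F.P Kt).d * (((F.P Kt).L ^ i - 1) / 2) + 1))
          (∑ i ∈ Finset.range (J' + 1), ((F.P Kt).d * (((F.P Kt).L ^ i - 1) / 2) + 1)) ≤
          ∑ i ∈ Finset.range (1 + 1), ((F.P Kt).d * (((F.P Kt).L ^ i - 1) / 2) + 1) :=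
        max_le (hℓmono (by omega)) (hℓmono hJ'le)
      have h1 := hRad 1 le_rfl hk1
      have h2 := hℓsucc 1
      have h3 := hℓsucc 0
      rw [Nat.sub_self, pow_zero, one_mul] at h1
      have hR : R + 4 ≤ ν.M₁ := by
        have hLm : (3 * ((F.P Kt).d * (((F.P Kt).L - 1) / 2)) + 5) * (F.P Kt).L ^ min (0 + 1) k ≤
            (3 * ((F.P Kt).d * (((F.P Kt).L - 1) / 2)) + 5) * (F.P Kt).L ^ min (1 + 1) k := Nat.mul_le_mul_left _ hLmono
        omega
      exact Or.inl (boxPlaqs_src_mem_hullD_of_near hM hy hxy hR hp)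
  exact exists_gaugeLetterLoc_atRecord_lamBondsSeq ν Kt hk0 hk hM2 hdiv Z hN hρn W 𝒞 hD hmin N hGN hN1 hεP hP hSΩ a θ hθ0 ha0 haN hθ ha hδ0 hWj

end Record

end Summit.QuantumFields.YangMills.BalabanUVNodes.N12GaugeLetterLocOfClassLam

end
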